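/-
COR-CM (cell pub-hodgecm2, stage 2 of the Hodge ladder) — junction B01, leg B01-O print-verbatim: the JOINT THETA-PINNED END DISPLAY
in MEETING FORM over the MODEL'S OWN Matsushima embedding `Model.embOf` — item (iii) DISCHARGED by name.  Authored and filed by
prover-pub-hodgecm2-b01-x1-0 (extra prover under the single owner of B01, `pub-hodgecm2-own-b01`; assignment (c) of HOME/INBOX
16:18:53Z, second file; path pre-ACKed by the lead's NAMING RULING l.4194 (3), `CorCM/B01/FaceWedgeMeet*.lean`), 2026-08-21.
Theorems only: no definition, no instance, no named fact cited as a record, nothing asserted; every import is BY NAME; `Interfaces.lean`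
(C1), the E term, `Transposition/*` and the other `CorCM/B01/*` files untouched.
FRAMING (COORDINATOR RULING 2026-08-21T11:55:35Z): `HC_CM` is NOT proved; every binder below is OPEN at a general face.
-/
import Summits.HodgeConjecture.CorCM.B01.Transposition.AssemblyFree
import Summits.HodgeConjecture.CorCM.B01.Transposition.Item6HeckeFamily
import Summits.HodgeConjecture.CorCM.B01.Transposition.Item5IsolationSpansHolds
import Summits.HodgeConjecture.CorCM.B01.Transposition.Item3InnerEmbHolds
import HarnessLib

/-!
# B01-O, print-verbatim, MEETING form over `Model.embOf`: the joint theta-pinned end display with item (iii) discharged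

The joint display `Model.hc_cm_of_jointThetaPin` (`CorCM/B01/FaceWedgeMeetJoint.lean`) carries item (iii)'s `L²` dictionary as
DATA + two Prop clauses: `(HG, emb, cover)`, `emb_cover` (β), `inner_emb` (γ).  On the model universe

* `HG := Lp ℂ 2 V.autMeasure` and `emb := Model.embOf` are CONSTRUCTED (`Transposition/Item3EmbOf.lean`, p289518), and (γ)
  `inner_emb` is the THEOREM `Model.embOf_inner_emb` for `2 < [L:ℚ]` (`Transposition/Item3InnerEmbHolds.lean`, p290113);
* (β) `emb_cover` is FALSE for the extension-by-zero adelic embedding `embOf` (stage-1 hazard C1, `Transposition/Item3Automorphic.lean`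
  header) — and is NOT NEEDED: the stage-1 E term of record consumes the MEETING forms C5′/C6′ instead, whose tree twin is the engine
  `Transposition.IsolationSpans.periodNV_ofSetting_meet` (`Item5IsolationSpansHolds.lean` §5; no `cover`, no level change).

Hence the display below, whose per-face hypothesis (∃-quantified per Galois CM field `F`, `6 ≤ [F:ℚ]`, and face `f`, at SOME
`(ι₁, V, σ)`) has NO item-(iii) binder left:
* DATA `S : Transposition.FaceThetaSupply U ι₁ V F f.psi σ` — theta sets `Θ_i ⊆ U_{ψ_i}` with SUPPLY INSIDE them [S2];
* DATA `Siso : Perl34.IsolationSetting H (Lp ℂ 2 V.autMeasure) CG G SK SigIdx SigIdxG` — item (v)'s INSTANCE (v-S) over the model's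
  own `L²([G_U])` (carrier types `H CG G SK SigIdx SigIdxG` and their instances are part of the datum);
* PROP (1) `S.TranslateClosed (Transposition.Model.heckeFamily …)` [PerL §3.1, tex ll. 652–656];
* PROP (2′) `gen12Meet` — C5′: a theta (12)-wedge of `S` with non-zero `embOf`-image is not orthogonal to `S₁₂ = Siso.t12.S12`
  [(v-g′); PKG `ThetaModel.Gen12MeetAt`, `Model/EndStateMeet.lean`:238; implied by `Gen12` via `IsolationSpans.gen12Meet_of_gen12`];
* PROP (3′) `real34Meet` — C6′: a (12)-wedge-function of `U_Ψ`-classes pairing non-trivially with a generator `ϑ_{T′,χ}(Φ)` of the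
  (34) side (`χ` allowed) pairs non-trivially, at ONE level, with a (34)-wedge-function of `U_Ψ`-classes [(v-r′); PKG
  `ThetaModel.Real34MeetAt` :245 — the realisation ∕ supply-family input for slots 2, 3].
NOT among the binders (tree theorems ∕ constructions): item (iii) entirely (`embOf`, `embOf_inner_emb`; no `cover`), B01-H
(`Transposition.Model.heckeWedge10Within_holds`), PerL Thm 3.7 (`Perl34.IsolationSetting.C2_S12_eq_S34`, consumed INSIDE the engine),
the universe facts, Hodge–Riemann (2,0), Landherr ∕ `∀ V`, admissibility, the chain rows, and on `U_rec` Hom-fullness.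

## Contents (namespace `Summit.HodgeConjecture.CorCM.Model`)
* `exists_periodNV_free_of_jointThetaPin_meeting` — the hypothesis gives FREE face-period witnesses
  `∀ F f, ∃ ι₁ V σ, U.PeriodNV ι₁ V F f.psi σ` on every instance of the model universe (line field by
  `universeOf_lineField_of_wedge_embOf` ∘ `wedge_of_translateClosed_heckeFamily`; then `periodNV_ofSetting_meet`).
* `hc_cm_of_jointThetaPin_meeting (hHD hI h₁ h₃) (hR) (h) : HC_CM` — via `hc_cm_of_exists_facePeriod_free`.
* `hc_cm_of_jointThetaPin_meeting_rec` — on the universe OF RECORD (`let U := U_rec`; ONE hypothesis).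
STRENGTH: hypothesis(joint, closure form, `FaceWedgeMeetJoint.lean`) specialised to `HG := Lp ℂ 2 V.autMeasure`, `emb := embOf`
IMPLIES this hypothesis clause by clause ((2) ⇒ (2′) `gen12Meet_of_gen12`; (3) ⇒ (3′) needs (β), which `embOf` lacks — so the two
displays are not kernel-comparable in general; this one is the shape the stage-1 E term instantiates, PKG `ModelAxiomsPerL.
thm44_of_realisation₂`, `Model/EndStateMeet.lean`:200–222).
-/

noncomputable section

open scoped TensorProduct InnerProductSpace

namespace Summit.HodgeConjecture.CorCM

open MeasureTheory
open Literature.AlgebraicGeometry.Motives (CMType HodgeStructure)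
open Literature.AlgebraicGeometry.Motives.HodgeStructure (conj)
open Literature.AlgebraicGeometry.HodgeTheory
open Literature.NumberTheory.Automorphic
open Literature.NumberTheory.Automorphic.PicardCM
open Prior.Perl34File (Perl34.IsolationSetting)
open Prior.Perl34File.Perl34

namespace Model

open Transposition

/-! ## §1  Free face-period witnesses from the joint theta-pinned datum in meeting form -/

/-- **The joint theta-pinned datum in MEETING form over `embOf` gives FREE face-period witnesses** on every instance of the model
universe.  Per face: Prop 4.3 for `S` from supply + B01-H within the honest Hecke family + translate-closure
(`Transposition.Model.wedge_of_translateClosed_heckeFamily`); the line field for `embOf` (`universeOf_lineField_of_wedge_embOf`,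
`2 < 6 ≤ [F:ℚ]`); then the meeting-form engine `IsolationSpans.periodNV_ofSetting_meet` with `inner_emb := embOf_inner_emb` and
`Theta_sub := S.Theta_sub`.  No item-(iii) binder. [folklore] -/
theorem exists_periodNV_free_of_jointThetaPin_meeting (hHD : exists_isReal_hodgeModel)
    (hI : hodgePQ_independent_of_hodgeModel) (h₁ : BallQuotientUniformised) (h₃ : CMAbelianVarietyRealised)
    (h : ∀ (F : CMField), IsGalois ℚ F → 6 ≤ Module.finrank ℚ F → ∀ f : Face F,
      ∃ (ι₁ : F →+* ℂ) (V : HermSpace3 F ι₁) (σ : F →+* ℂ)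
        (S : FaceThetaSupply (picardCMUniverse hHD hI h₁ h₃) ι₁ V F f.psi σ)
        (H CG G SK SigIdx SigIdxG : Type)
        (_ : NormedAddCommGroup H) (_ : InnerProductSpace ℂ H) (_ : CompleteSpace H)
        (_ : NormedAddCommGroup CG) (_ : NormedSpace ℂ CG) (_ : Group G) (_ : TopologicalSpace G) (_ : TopologicalSpace SK)
        (Siso : Perl34.IsolationSetting H (Lp ℂ 2 V.autMeasure) CG G SK SigIdx SigIdxG),
        S.TranslateClosed (Transposition.Model.heckeFamily hHD hI h₁ h₃) ∧
        (∀ (Γ : Level V) (ω₁ ω₂ : (picardCMUniverse hHD hI h₁ h₃).CohC ((picardCMUniverse hHD hI h₁ h₃).pms F ι₁ V Γ) 1),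
          ω₁ ∈ S.Theta 0 Γ → ω₂ ∈ S.Theta 1 Γ →
          embOf hHD hI (ballQuotientUniformisedDatum_of h₁) h₃ Γ
              ((picardCMUniverse hHD hI h₁ h₃).cup2C ((picardCMUniverse hHD hI h₁ h₃).pms F ι₁ V Γ) 1 ω₁ ω₂) ≠ 0 →
            ∃ u ∈ Siso.t12.S12,
              ⟪embOf hHD hI (ballQuotientUniformisedDatum_of h₁) h₃ Γ
                  ((picardCMUniverse hHD hI h₁ h₃).cup2C ((picardCMUniverse hHD hI h₁ h₃).pms F ι₁ V Γ) 1 ω₁ ω₂), u⟫_ℂ ≠ 0) ∧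
        (∀ χ : Siso.t34.X, Siso.t34.allowed χ → ∀ (Φ : SK) (Γ₁ : Level V)
          (ω₁ ω₂ : (picardCMUniverse hHD hI h₁ h₃).CohC ((picardCMUniverse hHD hI h₁ h₃).pms F ι₁ V Γ₁) 1),
          ω₁ ∈ (picardCMUniverse hHD hI h₁ h₃).Uiso Γ₁ F (f.psi 0) σ →
          ω₂ ∈ (picardCMUniverse hHD hI h₁ h₃).Uiso Γ₁ F (f.psi 1) σ →
            ⟪embOf hHD hI (ballQuotientUniformisedDatum_of h₁) h₃ Γ₁
                ((picardCMUniverse hHD hI h₁ h₃).cup2C ((picardCMUniverse hHD hI h₁ h₃).pms F ι₁ V Γ₁) 1 ω₁ ω₂),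
              Siso.t34.ϑ χ Φ⟫_ℂ ≠ 0 →
              ∃ (Γ : Level V) (ω : Fin 4 → (picardCMUniverse hHD hI h₁ h₃).CohC ((picardCMUniverse hHD hI h₁ h₃).pms F ι₁ V Γ) 1),
                (∀ i, ω i ∈ (picardCMUniverse hHD hI h₁ h₃).Uiso Γ F (f.psi i) σ) ∧
                ⟪embOf hHD hI (ballQuotientUniformisedDatum_of h₁) h₃ Γ
                    ((picardCMUniverse hHD hI h₁ h₃).cup2C ((picardCMUniverse hHD hI h₁ h₃).pms F ι₁ V Γ) 1 (ω 2) (ω 3)),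
                  embOf hHD hI (ballQuotientUniformisedDatum_of h₁) h₃ Γ
                    ((picardCMUniverse hHD hI h₁ h₃).cup2C ((picardCMUniverse hHD hI h₁ h₃).pms F ι₁ V Γ) 1 (ω 0) (ω 1))⟫_ℂ
                  ≠ 0)) :
    ∀ (F : CMField), IsGalois ℚ F → 6 ≤ Module.finrank ℚ F → ∀ f : Face F,
      ∃ (ι₁ : F →+* ℂ) (V : HermSpace3 F ι₁) (σ : F →+* ℂ), (picardCMUniverse hHD hI h₁ h₃).PeriodNV ι₁ V F f.psi σ := by
  intro F hG h6 f
  obtain ⟨ι₁, V, σ, S, H, CG, G, SK, SigIdx, SigIdxG, _, _, _, _, _, _, _, _, Siso, hT, hg, hr⟩ := h F hG h6 f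
  have hL : 2 < Module.finrank ℚ F := by omega
  refine ⟨ι₁, V, σ, ?_⟩
  exact IsolationSpans.periodNV_ofSetting_meet
    (universeOf_fact_pull_hodge hHD hI (ballQuotientUniformisedDatum_of h₁) h₃)
    (universeOf_fact_cup2_hodge hHD hI (ballQuotientUniformisedDatum_of h₁) h₃) Siso S.Theta_sub
    (universeOf_lineField_of_wedge_embOf hHD hI (ballQuotientUniformisedDatum_of h₁) h₃ hL S
      (Transposition.Model.wedge_of_translateClosed_heckeFamily S hT))
    hg hr (embOf_inner_emb hHD hI (ballQuotientUniformisedDatum_of h₁) h₃ hL V)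

/-! ## §2  The display -/

/-- **The joint theta-pinned end display in MEETING form over `embOf`.**  Per Galois CM field `F` of degree `≥ 6` and face `f`, at
SOME `(ι₁, V, σ)`: a theta supply datum `S`, translate-closure of its theta sets along the honest Hecke family, an isolation setting
`Siso` of the chosen seesaw configuration over the model's `L²` space `Lp ℂ 2 V.autMeasure`, and the two meeting-form Lemma-3.5 inputs
C5′ `gen12Meet` (for the theta sets of `S`) and C6′ `real34Meet` (for the generators of `Siso.t34`), all read through the model's
Matsushima embedding `Model.embOf` — give `HC_CM` (`hc_cm_of_exists_facePeriod_free`; `hR` = Hom-fullness, a tree theorem on the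
universe of record).  `HC_CM` is NOT proved: `h` is open at a general face. [folklore] -/
theorem hc_cm_of_jointThetaPin_meeting (hHD : exists_isReal_hodgeModel) (hI : hodgePQ_independent_of_hodgeModel)
    (h₁ : BallQuotientUniformised) (h₃ : CMAbelianVarietyRealised) (hR : DeligneMilne1982_Thm_6_20_full)
    (h : ∀ (F : CMField), IsGalois ℚ F → 6 ≤ Module.finrank ℚ F → ∀ f : Face F,
      ∃ (ι₁ : F →+* ℂ) (V : HermSpace3 F ι₁) (σ : F →+* ℂ)
        (S : FaceThetaSupply (picardCMUniverse hHD hI h₁ h₃) ι₁ V F f.psi σ)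
        (H CG G SK SigIdx SigIdxG : Type)
        (_ : NormedAddCommGroup H) (_ : InnerProductSpace ℂ H) (_ : CompleteSpace H)
        (_ : NormedAddCommGroup CG) (_ : NormedSpace ℂ CG) (_ : Group G) (_ : TopologicalSpace G) (_ : TopologicalSpace SK)
        (Siso : Perl34.IsolationSetting H (Lp ℂ 2 V.autMeasure) CG G SK SigIdx SigIdxG),
        S.TranslateClosed (Transposition.Model.heckeFamily hHD hI h₁ h₃) ∧
        (∀ (Γ : Level V) (ω₁ ω₂ : (picardCMUniverse hHD hI h₁ h₃).CohC ((picardCMUniverse hHD hI h₁ h₃).pms F ι₁ V Γ) 1),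
          ω₁ ∈ S.Theta 0 Γ → ω₂ ∈ S.Theta 1 Γ →
          embOf hHD hI (ballQuotientUniformisedDatum_of h₁) h₃ Γ
              ((picardCMUniverse hHD hI h₁ h₃).cup2C ((picardCMUniverse hHD hI h₁ h₃).pms F ι₁ V Γ) 1 ω₁ ω₂) ≠ 0 →
            ∃ u ∈ Siso.t12.S12,
              ⟪embOf hHD hI (ballQuotientUniformisedDatum_of h₁) h₃ Γ
                  ((picardCMUniverse hHD hI h₁ h₃).cup2C ((picardCMUniverse hHD hI h₁ h₃).pms F ι₁ V Γ) 1 ω₁ ω₂), u⟫_ℂ ≠ 0) ∧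
        (∀ χ : Siso.t34.X, Siso.t34.allowed χ → ∀ (Φ : SK) (Γ₁ : Level V)
          (ω₁ ω₂ : (picardCMUniverse hHD hI h₁ h₃).CohC ((picardCMUniverse hHD hI h₁ h₃).pms F ι₁ V Γ₁) 1),
          ω₁ ∈ (picardCMUniverse hHD hI h₁ h₃).Uiso Γ₁ F (f.psi 0) σ →
          ω₂ ∈ (picardCMUniverse hHD hI h₁ h₃).Uiso Γ₁ F (f.psi 1) σ →
            ⟪embOf hHD hI (ballQuotientUniformisedDatum_of h₁) h₃ Γ₁
                ((picardCMUniverse hHD hI h₁ h₃).cup2C ((picardCMUniverse hHD hI h₁ h₃).pms F ι₁ V Γ₁) 1 ω₁ ω₂),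
              Siso.t34.ϑ χ Φ⟫_ℂ ≠ 0 →
              ∃ (Γ : Level V) (ω : Fin 4 → (picardCMUniverse hHD hI h₁ h₃).CohC ((picardCMUniverse hHD hI h₁ h₃).pms F ι₁ V Γ) 1),
                (∀ i, ω i ∈ (picardCMUniverse hHD hI h₁ h₃).Uiso Γ F (f.psi i) σ) ∧
                ⟪embOf hHD hI (ballQuotientUniformisedDatum_of h₁) h₃ Γ
                    ((picardCMUniverse hHD hI h₁ h₃).cup2C ((picardCMUniverse hHD hI h₁ h₃).pms F ι₁ V Γ) 1 (ω 2) (ω 3)),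
                  embOf hHD hI (ballQuotientUniformisedDatum_of h₁) h₃ Γ
                    ((picardCMUniverse hHD hI h₁ h₃).cup2C ((picardCMUniverse hHD hI h₁ h₃).pms F ι₁ V Γ) 1 (ω 0) (ω 1))⟫_ℂ
                  ≠ 0)) :
    HC_CM :=
  hc_cm_of_exists_facePeriod_free hHD hI h₁ h₃ (exists_periodNV_free_of_jointThetaPin_meeting hHD hI h₁ h₃ h) hR

/-! ## §3  The universe of record -/

/-- **The meeting-form joint display on the universe OF RECORD** (the four `_holds` data and `deligneMilne1982_Thm_6_20_full_holds`
plugged in; ONE hypothesis; `let U := U_rec`, `let hU := ballQuotientUniformisedDatum_of ballQuotientUniformised_holds` for legibility).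
`HC_CM` is NOT proved: the hypothesis is open at a general face. [folklore] -/
theorem hc_cm_of_jointThetaPin_meeting_rec :
    let U := picardCMUniverse exists_isReal_hodgeModel_holds hodgePQ_independent_of_hodgeModel_holds
      BallQuotient.ballQuotientUniformised_holds cmAbelianVarietyRealised_holds
    let hU := ballQuotientUniformisedDatum_of BallQuotient.ballQuotientUniformised_holds
    (∀ (F : CMField), IsGalois ℚ F → 6 ≤ Module.finrank ℚ F → ∀ f : Face F,
      ∃ (ι₁ : F →+* ℂ) (V : HermSpace3 F ι₁) (σ : F →+* ℂ)
        (S : FaceThetaSupply U ι₁ V F f.psi σ)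
        (H CG G SK SigIdx SigIdxG : Type)
        (_ : NormedAddCommGroup H) (_ : InnerProductSpace ℂ H) (_ : CompleteSpace H)
        (_ : NormedAddCommGroup CG) (_ : NormedSpace ℂ CG) (_ : Group G) (_ : TopologicalSpace G) (_ : TopologicalSpace SK)
        (Siso : Perl34.IsolationSetting H (Lp ℂ 2 V.autMeasure) CG G SK SigIdx SigIdxG),
        S.TranslateClosed (Transposition.Model.heckeFamily exists_isReal_hodgeModel_holds hodgePQ_independent_of_hodgeModel_holds
          BallQuotient.ballQuotientUniformised_holds cmAbelianVarietyRealised_holds) ∧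
        (∀ (Γ : Level V) (ω₁ ω₂ : U.CohC (U.pms F ι₁ V Γ) 1), ω₁ ∈ S.Theta 0 Γ → ω₂ ∈ S.Theta 1 Γ →
          embOf exists_isReal_hodgeModel_holds hodgePQ_independent_of_hodgeModel_holds hU cmAbelianVarietyRealised_holds Γ (U.cup2C (U.pms F ι₁ V Γ) 1 ω₁ ω₂) ≠ 0 →
            ∃ u ∈ Siso.t12.S12, ⟪embOf exists_isReal_hodgeModel_holds hodgePQ_independent_of_hodgeModel_holds hU cmAbelianVarietyRealised_holds Γ (U.cup2C (U.pms F ι₁ V Γ) 1 ω₁ ω₂), u⟫_ℂ ≠ 0) ∧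
        (∀ χ : Siso.t34.X, Siso.t34.allowed χ → ∀ (Φ : SK) (Γ₁ : Level V) (ω₁ ω₂ : U.CohC (U.pms F ι₁ V Γ₁) 1),
          ω₁ ∈ U.Uiso Γ₁ F (f.psi 0) σ → ω₂ ∈ U.Uiso Γ₁ F (f.psi 1) σ →
            ⟪embOf exists_isReal_hodgeModel_holds hodgePQ_independent_of_hodgeModel_holds hU cmAbelianVarietyRealised_holds Γ₁ (U.cup2C (U.pms F ι₁ V Γ₁) 1 ω₁ ω₂), Siso.t34.ϑ χ Φ⟫_ℂ ≠ 0 →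
              ∃ (Γ : Level V) (ω : Fin 4 → U.CohC (U.pms F ι₁ V Γ) 1), (∀ i, ω i ∈ U.Uiso Γ F (f.psi i) σ) ∧
                ⟪embOf exists_isReal_hodgeModel_holds hodgePQ_independent_of_hodgeModel_holds hU cmAbelianVarietyRealised_holds Γ (U.cup2C (U.pms F ι₁ V Γ) 1 (ω 2) (ω 3)),
                  embOf exists_isReal_hodgeModel_holds hodgePQ_independent_of_hodgeModel_holds hU cmAbelianVarietyRealised_holds Γ (U.cup2C (U.pms F ι₁ V Γ) 1 (ω 0) (ω 1))⟫_ℂ ≠ 0)) →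
    HC_CM :=
  fun h ↦ hc_cm_of_jointThetaPin_meeting _ _ _ _ deligneMilne1982_Thm_6_20_full_holds h

#print axioms hc_cm_of_jointThetaPin_meeting_rec

end Model

end Summit.HodgeConjecture.CorCM

end
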